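import Summits.Ventures.HodgeRepro2.T5SU11BetaImproper

/-!
# The Beta integral in exponential coordinates: `∫_ℝ e^{-2at} (1 + e^{-2t})^{-(a+b)} dt = Γ(a) Γ(b)/(2 Γ(a+b))`,
and the horocycle integral `∫_ℝ (c² + s²)^{-k/2} ds = c^{1−k} √π Γ((k−1)/2)/Γ(k/2)`

The substitution `x = e^{-2t}` (`ℝ → (0, ∞)`, Jacobian `2 e^{-2t}`) through
`MeasureTheory.integral_image_eq_integral_abs_deriv_smul` turns the `(0, ∞)` Beta integral of
`T5SU11BetaImproper` into **`∫_ℝ e^{-2at} (1 + e^{-2t})^{-(a+b)} dt = Γ(a) Γ(b)/(2 Γ(a + b))`** for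
`a, b > 0` (`integral_exp_mul_one_add_exp_rpow_neg`), with integrability a posteriori
(`integrable_exp_mul_one_add_exp_rpow_neg`). The scaled `(1 + u²)^{-s}` integral is restated for the
weight `k = 2s`: **`∫_ℝ (c² + s²)^{-k/2} ds = c^{1−k} √π Γ((k−1)/2)/Γ(k/2)`** for `k > 1`, `c > 0`
(`integral_sq_add_sq_rpow_neg_half`), together with its integrability. These are exactly the two
one-dimensional integrals of the Iwasawa-coordinate evaluation of
`∫_G (1 − |g·0|²)^{k/2} e^{λ t(g)} dν(g)` (`g = a_t n_s`: `|a(a_t n_s)|² = cosh² t + s² e^{2t}`, the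
`s`-integral is the horocycle integral with `c = e^{-t} cosh t`, the `t`-integral the exponential Beta
integral). Nothing is claimed about (N).

Blind lane: Mathlib + the HodgeRepro2 prefix only; no sorry; axioms ⊆ {propext, Classical.choice,
Quot.sound}.
-/

namespace Summit.Ventures.HodgeRepro2.T5SU11BetaExp

open MeasureTheory Metric Set Filter Topology intervalIntegral
open T5SU11SphericalCfunClosed T5SU11BetaImproper
open scoped Real

/-! ### The substitution `x = e^{-2t}` -/

/-- The range of `t ↦ e^{-2t}` is `(0, ∞)`. -/
lemma range_exp_neg_two_mul : range (fun t : ℝ => Real.exp (-2 * t)) = Ioi 0 := by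
  ext x
  constructor
  · rintro ⟨t, rfl⟩
    exact Real.exp_pos _
  · intro hx
    refine ⟨-(Real.log x) / 2, ?_⟩
    simp only
    rw [show -2 * (-(Real.log x) / 2) = Real.log x by ring, Real.exp_log hx]

/-- `t ↦ e^{-2t}` is injective. -/
lemma injective_exp_neg_two_mul : Function.Injective (fun t : ℝ => Real.exp (-2 * t)) := by
  intro t₁ t₂ h
  have := Real.exp_injective h
  linarith

/-- The derivative of `t ↦ e^{-2t}` is `-2 e^{-2t}`. -/
lemma hasDerivAt_exp_neg_two_mul (t : ℝ) :
    HasDerivAt (fun t : ℝ => Real.exp (-2 * t)) (-2 * Real.exp (-2 * t)) t := by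
  have h := (Real.hasDerivAt_exp (-2 * t)).comp t ((hasDerivAt_id t).const_mul (-2))
  refine h.congr_deriv ?_
  simp only [mul_one]
  ring

/-- **The Beta integral in exponential coordinates**:
`∫_ℝ e^{-2at} (1 + e^{-2t})^{-(a+b)} dt = Γ(a) Γ(b)/(2 Γ(a + b))` for `a, b > 0`. -/
theorem integral_exp_mul_one_add_exp_rpow_neg {a b : ℝ} (ha : 0 < a) (hb : 0 < b) :
    ∫ t : ℝ, Real.exp (-(2 * a) * t) * (1 + Real.exp (-2 * t)) ^ (-(a + b))
      = Real.Gamma a * Real.Gamma b / (2 * Real.Gamma (a + b)) := by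
  have hder : ∀ t ∈ (univ : Set ℝ), HasDerivWithinAt (fun t : ℝ => Real.exp (-2 * t))
      (-2 * Real.exp (-2 * t)) univ t :=
    fun t _ => (hasDerivAt_exp_neg_two_mul t).hasDerivWithinAt
  have key := integral_image_eq_integral_abs_deriv_smul MeasurableSet.univ hder
    injective_exp_neg_two_mul.injOn (fun x : ℝ => x ^ (a - 1) * (1 + x) ^ (-(a + b)))
  rw [image_univ, range_exp_neg_two_mul, Measure.restrict_univ,
    integral_rpow_mul_one_add_rpow_neg ha hb] at key
  have hpt : ∀ t : ℝ, |-2 * Real.exp (-2 * t)| •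
      (Real.exp (-2 * t) ^ (a - 1) * (1 + Real.exp (-2 * t)) ^ (-(a + b)))
      = 2 * (Real.exp (-(2 * a) * t) * (1 + Real.exp (-2 * t)) ^ (-(a + b))) := by
    intro t
    rw [smul_eq_mul, abs_of_neg (by have := Real.exp_pos (-2 * t); linarith), ← Real.exp_mul,
      show -2 * t * (a - 1) = -(2 * a) * t + 2 * t by ring, Real.exp_add]
    have h1 : Real.exp (-2 * t) * Real.exp (2 * t) = 1 := by
      rw [← Real.exp_add, show -2 * t + 2 * t = 0 by ring, Real.exp_zero]
    linear_combination (2 * Real.exp (-(2 * a) * t) * (1 + Real.exp (-2 * t)) ^ (-(a + b))) * h1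
  simp_rw [hpt] at key
  rw [MeasureTheory.integral_const_mul] at key
  have hΓ : 0 < Real.Gamma (a + b) := Real.Gamma_pos_of_pos (by linarith)
  rw [eq_div_iff (mul_pos two_pos hΓ).ne']
  rw [eq_comm, eq_div_iff hΓ.ne'] at key
  linarith [key]

/-- `e^{-2at} (1 + e^{-2t})^{-(a+b)}` is integrable on `ℝ` for `a, b > 0` (a posteriori). -/
theorem integrable_exp_mul_one_add_exp_rpow_neg {a b : ℝ} (ha : 0 < a) (hb : 0 < b) :
    Integrable (fun t : ℝ => Real.exp (-(2 * a) * t) * (1 + Real.exp (-2 * t)) ^ (-(a + b))) := by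
  by_contra h
  have h0 := integral_undef h
  rw [integral_exp_mul_one_add_exp_rpow_neg ha hb] at h0
  have h1 : 0 < Real.Gamma a := Real.Gamma_pos_of_pos ha
  have h2 : 0 < Real.Gamma b := Real.Gamma_pos_of_pos hb
  have h3 : 0 < Real.Gamma (a + b) := Real.Gamma_pos_of_pos (by linarith)
  have : 0 < Real.Gamma a * Real.Gamma b / (2 * Real.Gamma (a + b)) := by positivity
  linarith

/-! ### The horocycle integral for the weight `k` -/

/-- **The horocycle integral**: `∫_ℝ (c² + s²)^{-k/2} ds = c^{1−k} √π Γ((k−1)/2)/Γ(k/2)` for `k > 1`,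
`c > 0`. -/
theorem integral_sq_add_sq_rpow_neg_half {k c : ℝ} (hk : 1 < k) (hc : 0 < c) :
    ∫ s : ℝ, (c ^ 2 + s ^ 2) ^ (-(k / 2))
      = c ^ (1 - k) * (√π * Real.Gamma ((k - 1) / 2) / Real.Gamma (k / 2)) := by
  rw [integral_sq_add_sq_rpow_neg (by linarith) hc, show 1 - 2 * (k / 2) = 1 - k by ring,
    show k / 2 - 1 / 2 = (k - 1) / 2 by ring]

/-- `(c² + s²)^{-k/2}` is integrable on `ℝ` for `k > 1`, `c > 0`. -/
theorem integrable_sq_add_sq_rpow_neg_half {k c : ℝ} (hk : 1 < k) (hc : 0 < c) :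
    Integrable (fun s : ℝ => (c ^ 2 + s ^ 2) ^ (-(k / 2))) := by
  by_contra h
  have h0 := integral_undef h
  rw [integral_sq_add_sq_rpow_neg_half hk hc] at h0
  have h1 : 0 < Real.Gamma ((k - 1) / 2) := Real.Gamma_pos_of_pos (by linarith)
  have h2 : 0 < Real.Gamma (k / 2) := Real.Gamma_pos_of_pos (by linarith)
  have h3 : 0 < c ^ (1 - k) := Real.rpow_pos_of_pos hc _
  have : 0 < c ^ (1 - k) * (√π * Real.Gamma ((k - 1) / 2) / Real.Gamma (k / 2)) := by positivity
  linarith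

/-- The horocycle integrand in the form it takes on `a_t n_s`:
`(cosh² t + s² e^{2t})^{-k/2} = e^{-kt} ((e^{-t} cosh t)² + s²)^{-k/2}`. -/
lemma cosh_sq_add_sq_mul_exp_rpow (k t s : ℝ) :
    (Real.cosh t ^ 2 + s ^ 2 * Real.exp (2 * t)) ^ (-(k / 2))
      = Real.exp (-k * t) * ((Real.exp (-t) * Real.cosh t) ^ 2 + s ^ 2) ^ (-(k / 2)) := by
  have he : 0 < Real.exp (2 * t) := Real.exp_pos _
  have h1 : Real.cosh t ^ 2 + s ^ 2 * Real.exp (2 * t)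
      = Real.exp (2 * t) * ((Real.exp (-t) * Real.cosh t) ^ 2 + s ^ 2) := by
    have h2 : Real.exp (2 * t) * Real.exp (-t) ^ 2 = 1 := by
      rw [← Real.exp_nat_mul, ← Real.exp_add]
      simp
    linear_combination (-(Real.cosh t ^ 2)) * h2
  rw [h1, Real.mul_rpow he.le (by positivity), ← Real.exp_mul]
  congr 2
  ring

/-- **The horocycle integral on `a_t n_s`**: for `k > 1` and every `t`,
`∫_ℝ (cosh² t + s² e^{2t})^{-k/2} ds = 2^{k−1} e^{-kt} (1 + e^{-2t})^{1−k} √π Γ((k−1)/2)/Γ(k/2)`. -/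
theorem integral_cosh_sq_add_sq_mul_exp_rpow {k : ℝ} (hk : 1 < k) (t : ℝ) :
    ∫ s : ℝ, (Real.cosh t ^ 2 + s ^ 2 * Real.exp (2 * t)) ^ (-(k / 2))
      = 2 ^ (k - 1) * Real.exp (-k * t) * (1 + Real.exp (-2 * t)) ^ (1 - k)
          * (√π * Real.Gamma ((k - 1) / 2) / Real.Gamma (k / 2)) := by
  have hc : 0 < Real.exp (-t) * Real.cosh t := mul_pos (Real.exp_pos _) (Real.cosh_pos t)
  simp_rw [cosh_sq_add_sq_mul_exp_rpow k t]
  rw [MeasureTheory.integral_const_mul, integral_sq_add_sq_rpow_neg_half hk hc]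
  have h1 : Real.exp (-t) * Real.cosh t = (1 + Real.exp (-2 * t)) / 2 := by
    rw [Real.cosh_eq]
    have e1 : Real.exp (-t) * Real.exp t = 1 := by
      rw [← Real.exp_add, show -t + t = 0 by ring, Real.exp_zero]
    have e2 : Real.exp (-t) * Real.exp (-t) = Real.exp (-2 * t) := by
      rw [← Real.exp_add]; congr 1; ring
    linear_combination (1 / 2 : ℝ) * e1 + (1 / 2 : ℝ) * e2
  have h2 : (2 : ℝ) ^ (1 - k) = (2 ^ (k - 1))⁻¹ := by
    rw [show (1 - k) = -(k - 1) by ring, Real.rpow_neg (by norm_num)]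
  rw [h1, Real.div_rpow (by positivity) (by norm_num), h2]
  have h3 : (0 : ℝ) < 2 ^ (k - 1) := Real.rpow_pos_of_pos (by norm_num) _
  field_simp

/-- `(cosh² t + s² e^{2t})^{-k/2}` is integrable in `s` for `k > 1`. -/
theorem integrable_cosh_sq_add_sq_mul_exp_rpow {k : ℝ} (hk : 1 < k) (t : ℝ) :
    Integrable (fun s : ℝ => (Real.cosh t ^ 2 + s ^ 2 * Real.exp (2 * t)) ^ (-(k / 2))) := by
  have hc : 0 < Real.exp (-t) * Real.cosh t := mul_pos (Real.exp_pos _) (Real.cosh_pos t)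
  simp_rw [cosh_sq_add_sq_mul_exp_rpow k t]
  exact (integrable_sq_add_sq_rpow_neg_half hk hc).const_mul _

/-! ### The `t`-integral after the horocycle integration -/

/-- The `t`-integrand after the horocycle integration, in Beta form:
`e^{λt} · e^{-kt} (1 + e^{-2t})^{1−k} = e^{-2at} (1 + e^{-2t})^{-(a+b)}` with `a = (k − λ)/2`,
`b = (k + λ)/2 − 1`. -/
lemma exp_mul_exp_mul_one_add_exp_rpow (k lam t : ℝ) :
    Real.exp (lam * t) * (Real.exp (-k * t) * (1 + Real.exp (-2 * t)) ^ (1 - k))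
      = Real.exp (-(2 * ((k - lam) / 2)) * t)
          * (1 + Real.exp (-2 * t)) ^ (-((k - lam) / 2 + ((k + lam) / 2 - 1))) := by
  rw [← mul_assoc, ← Real.exp_add]
  congr 2 <;> ring

/-- **The `t`-integral of the horocycle integrals**: for `k > 1`, `λ < k` and `k + λ > 2`,
`∫_ℝ e^{λt} · 2^{k−1} e^{-kt} (1 + e^{-2t})^{1−k} C_k dt = 2^{k−2} C_k Γ((k−λ)/2) Γ((k+λ)/2 − 1)/Γ(k − 1)`
with `C_k = √π Γ((k−1)/2)/Γ(k/2)`. -/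
theorem integral_exp_mul_horocycle {k lam : ℝ} (hk : 1 < k) (h1 : lam < k) (h2 : 2 < k + lam) :
    ∫ t : ℝ, Real.exp (lam * t) * (2 ^ (k - 1) * Real.exp (-k * t) * (1 + Real.exp (-2 * t)) ^ (1 - k)
        * (√π * Real.Gamma ((k - 1) / 2) / Real.Gamma (k / 2)))
      = 2 ^ (k - 2) * (√π * Real.Gamma ((k - 1) / 2) / Real.Gamma (k / 2))
          * (Real.Gamma ((k - lam) / 2) * Real.Gamma ((k + lam) / 2 - 1) / Real.Gamma (k - 1)) := by
  have ha : 0 < (k - lam) / 2 := by linarith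
  have hb : 0 < (k + lam) / 2 - 1 := by linarith
  have hpt : ∀ t : ℝ, Real.exp (lam * t) * (2 ^ (k - 1) * Real.exp (-k * t)
      * (1 + Real.exp (-2 * t)) ^ (1 - k) * (√π * Real.Gamma ((k - 1) / 2) / Real.Gamma (k / 2)))
      = (2 ^ (k - 1) * (√π * Real.Gamma ((k - 1) / 2) / Real.Gamma (k / 2)))
        * (Real.exp (-(2 * ((k - lam) / 2)) * t)
          * (1 + Real.exp (-2 * t)) ^ (-((k - lam) / 2 + ((k + lam) / 2 - 1)))) := by
    intro t
    rw [← exp_mul_exp_mul_one_add_exp_rpow]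
    ring
  simp_rw [hpt]
  rw [MeasureTheory.integral_const_mul, integral_exp_mul_one_add_exp_rpow_neg ha hb,
    show (k - lam) / 2 + ((k + lam) / 2 - 1) = k - 1 by ring,
    show (2 : ℝ) ^ (k - 1) = 2 ^ (k - 2) * 2 by
      rw [show k - 1 = (k - 2) + 1 by ring, Real.rpow_add (by norm_num), Real.rpow_one]]
  have hΓ : 0 < Real.Gamma (k - 1) := Real.Gamma_pos_of_pos (by linarith)
  field_simp

/-- The `t`-integrand of `integral_exp_mul_horocycle` is integrable (a posteriori). -/
theorem integrable_exp_mul_horocycle {k lam : ℝ} (hk : 1 < k) (h1 : lam < k) (h2 : 2 < k + lam) :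
    Integrable (fun t : ℝ => Real.exp (lam * t) * (2 ^ (k - 1) * Real.exp (-k * t)
      * (1 + Real.exp (-2 * t)) ^ (1 - k) * (√π * Real.Gamma ((k - 1) / 2) / Real.Gamma (k / 2)))) := by
  by_contra h
  have h0 := integral_undef h
  rw [integral_exp_mul_horocycle hk h1 h2] at h0
  have g1 : 0 < Real.Gamma ((k - 1) / 2) := Real.Gamma_pos_of_pos (by linarith)
  have g2 : 0 < Real.Gamma (k / 2) := Real.Gamma_pos_of_pos (by linarith)
  have g3 : 0 < Real.Gamma ((k - lam) / 2) := Real.Gamma_pos_of_pos (by linarith)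
  have g4 : 0 < Real.Gamma ((k + lam) / 2 - 1) := Real.Gamma_pos_of_pos (by linarith)
  have g5 : 0 < Real.Gamma (k - 1) := Real.Gamma_pos_of_pos (by linarith)
  have g6 : (0 : ℝ) < 2 ^ (k - 2) := Real.rpow_pos_of_pos (by norm_num) _
  have : 0 < 2 ^ (k - 2) * (√π * Real.Gamma ((k - 1) / 2) / Real.Gamma (k / 2))
      * (Real.Gamma ((k - lam) / 2) * Real.Gamma ((k + lam) / 2 - 1) / Real.Gamma (k - 1)) := by
    positivity
  linarith

end Summit.Ventures.HodgeRepro2.T5SU11BetaExp
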